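import Literature.Analysis.FluidPDE.VorticityDirectionDepletion
import Literature.Analysis.FluidPDE.BiotSavartBounds
import Literature.Analysis.FluidPDE.NewtonPotentialHolder
import Literature.Analysis.FluidPDE.LocalHelmholtzSupBound
import Mathlib.Analysis.Calculus.ParametricIntegral
import HarnessLib

/-!
# ArgmaxDoorsDepletionTools — door family S35 «ArgmaxDoors», tools for plate D «PointDepletion»

S-door lane helper (ns-sfl-p1 g5; texts nsreg-p1 g29 ROUND-33 `r33/Sketch35.lean`, plate D — door C only).
Plate D bounds the stretching rate at ONE point by Constantin–Fefferman's depleted singular integral. The tree's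
depletion lemma `exists_abs_inner_fderiv_biotSavart_le` (`VorticityDirectionDepletion`) wants a COMPACTLY SUPPORTED
Hölder density; a vorticity slice of the class is only `C^∞ ∩ L²`. This file supplies the two missing pieces:

* `hasFDerivAt_biotSavart_far` — **the far field is harmless**: if `h` is continuous, `∫‖h‖² < ∞` and `h = 0` on
  the ball `B(x₀, R)`, then `K ∗ h` is differentiable at `x₀`, its Biot–Savart integrand is absolutely convergent
  near `x₀`, and `‖∇(K ∗ h)(x₀)‖ ≤ 8A ∫_{|x₀−y| ≥ R} ‖h(y)‖ |x₀ − y|⁻³ dy` (differentiation under the integral,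
  Mathlib `hasFDerivAt_integral_of_dominated_of_fderiv_le`, domination `‖∇K(x − y)‖ ≤ A|x − y|⁻³ ≤ 8A|x₀ − y|⁻³`
  for `|x − x₀| < R/2 ≤ |x₀ − y|/2`; the dominating function is integrable as a product of two `L²` functions,
  `ab ≤ (a² + b²)/2`, `∫_{|z| ≥ R}|z|⁻⁶ < ∞`);
* `tendsto_integral_norm_mul_farCube` — the tail `∫_{|x₀−y| ≥ n+1} ‖ω(y)‖ |x₀ − y|⁻³ dy → 0` (dominated
  convergence);
* `integrable_depletionIntegrand` — **the depletion integrand is integrable**: for `ω ∈ C¹` with `∫‖ω‖² < ∞`,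
  `y ↦ ‖ω(y) − ⟪ω(y), ξ⟫ξ‖ |x₀ − y|⁻³`, `ξ = ω(x₀)/|ω(x₀)|`, is integrable (near `x₀`: the projection kills
  `ω(x₀)`, so the numerator is `≤ ‖ω(y) − ω(x₀)‖ ≤ L|y − x₀|` and the integrand `≤ L|x₀ − y|⁻²`; far: `ab ≤ (a²+b²)/2`).

No definitions (the far kernels are written as indicators inline). Mathlib / tree search: `lean search
'hasFDerivAt.*biotSavart|far.*biotSavart|integrable.*inv_sq'` — the tree differentiates compactly supported
densities only (`hasFDerivAt_biotSavart`, `hasFDerivAt_truncPotential`); its `L²` kernel integrability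
(`BiotSavartRepresentationSqIntegrable.integrable_norm_mul_inv_sq`) is private; the far-field derivative is new here.

WHAT THIS IS NOT: kernel calculus for a regularity CRITERION (door S35-C) about hypothetical blow-up; item 0056
`NoTypeII` and NS regularity are NOT proved; nothing here is a route or a summit statement.
-/

-- the summit's problem namespace repeats the summit name (tree layout)
set_option linter.dupNamespace false

noncomputable section

open MeasureTheory Set Function Filter Metric Real InnerProductSpace
open scoped ENNReal NNReal RealInnerProductSpace Topology

namespace Summit.NavierStokesRegularity.NavierStokesRegularity.Theorems.ArgmaxDoors

open Literature.Analysis.FluidPDE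

/-! ### Far kernels `1_{|z| ≥ R} |z|^{-k}`: square integrability and the product trick -/

/-- `∫_{|z| ≥ R} |z|^{-2k} dz < ∞` for `k ≥ 2`, `R > 0`, written for the translated far kernel
`y ↦ 1_{|x₀ − y| ≥ R} |x₀ − y|^{-k}`. -/
theorem integrable_sq_farKernel {k : ℕ} (hk : 2 ≤ k) {R : ℝ} (hR : 0 < R)
    (x₀ : EuclideanSpace ℝ (Fin 3)) :
    Integrable fun y : EuclideanSpace ℝ (Fin 3) =>
      ((ball (0 : EuclideanSpace ℝ (Fin 3)) R)ᶜ.indicator (fun z => (‖z‖ ^ k)⁻¹) (x₀ - y)) ^ 2 := by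
  have hfar : Integrable fun z : EuclideanSpace ℝ (Fin 3) =>
      ((ball (0 : EuclideanSpace ℝ (Fin 3)) R)ᶜ.indicator (fun z => (‖z‖ ^ k)⁻¹) z) ^ 2 := by
    have heq : (fun z : EuclideanSpace ℝ (Fin 3) =>
        ((ball (0 : EuclideanSpace ℝ (Fin 3)) R)ᶜ.indicator (fun z => (‖z‖ ^ k)⁻¹) z) ^ 2) =
        (ball (0 : EuclideanSpace ℝ (Fin 3)) R)ᶜ.indicator fun z => ‖z‖ ^ (-(2 * k : ℝ)) := by
      funext z
      by_cases hz : z ∈ (ball (0 : EuclideanSpace ℝ (Fin 3)) R)ᶜ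
      · have hzpos : 0 < ‖z‖ := by
          rw [mem_compl_iff, mem_ball_zero_iff, not_lt] at hz
          exact hR.trans_le hz
        rw [indicator_of_mem hz, indicator_of_mem hz, Real.rpow_neg hzpos.le, ← inv_pow, ← pow_mul,
          ← Real.rpow_natCast, inv_rpow hzpos.le]
        norm_num
        rw [mul_comm]
      · rw [indicator_of_notMem hz, indicator_of_notMem hz, zero_pow two_ne_zero]
    rw [heq, integrable_indicator_iff measurableSet_ball.compl]
    have hk' : (3 : ℝ) < 2 * k := by
      have : (2 : ℝ) ≤ k := by exact_mod_cast hk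
      linarith
    exact NewtonPotentialHolder.integrableOn_compl_ball_norm_rpow_neg hk' hR
  exact hfar.comp_sub_left x₀

/-- The far kernel is nonnegative. -/
theorem farKernel_nonneg (k : ℕ) (R : ℝ) (z : EuclideanSpace ℝ (Fin 3)) :
    0 ≤ (ball (0 : EuclideanSpace ℝ (Fin 3)) R)ᶜ.indicator (fun z => (‖z‖ ^ k)⁻¹) z :=
  indicator_nonneg (fun _ _ => by positivity) z

/-- The far kernel is measurable (composed with `y ↦ x₀ − y`). -/
theorem measurable_farKernel_sub (k : ℕ) (R : ℝ) (x₀ : EuclideanSpace ℝ (Fin 3)) :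
    Measurable fun y : EuclideanSpace ℝ (Fin 3) =>
      (ball (0 : EuclideanSpace ℝ (Fin 3)) R)ᶜ.indicator (fun z => (‖z‖ ^ k)⁻¹) (x₀ - y) := by
  have h1 : Measurable fun z : EuclideanSpace ℝ (Fin 3) =>
      (ball (0 : EuclideanSpace ℝ (Fin 3)) R)ᶜ.indicator (fun z => (‖z‖ ^ k)⁻¹) z :=
    ((measurable_norm.pow_const k).inv).indicator measurableSet_ball.compl
  exact h1.comp (measurable_const.sub measurable_id)

/-- Off the ball the far kernel is the power: `|x₀ − y| ≥ R ⇒ 1_{≥R}|x₀−y|^{-k} = |x₀ − y|^{-k}`. -/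
theorem farKernel_eq_of_le {k : ℕ} {R : ℝ} {x₀ y : EuclideanSpace ℝ (Fin 3)} (hy : R ≤ ‖x₀ - y‖) :
    (ball (0 : EuclideanSpace ℝ (Fin 3)) R)ᶜ.indicator (fun z => (‖z‖ ^ k)⁻¹) (x₀ - y) =
      (‖x₀ - y‖ ^ k)⁻¹ := by
  have hmem : x₀ - y ∈ (ball (0 : EuclideanSpace ℝ (Fin 3)) R)ᶜ := by
    rw [mem_compl_iff, mem_ball_zero_iff, not_lt]; exact hy
  exact indicator_of_mem hmem _

/-- **The product trick**: a measurable `F` with `‖F‖ ≤ a·b`, `a, b` square integrable, is integrable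
(`ab ≤ (a² + b²)/2`; no Hölder inequality needed). -/
theorem integrable_of_norm_le_mul_sq {G : Type*} [NormedAddCommGroup G]
    {F : EuclideanSpace ℝ (Fin 3) → G}
    (hFm : AEStronglyMeasurable F volume) {a b : EuclideanSpace ℝ (Fin 3) → ℝ}
    (ha : Integrable fun y => a y ^ 2) (hb : Integrable fun y => b y ^ 2)
    (hle : ∀ y, ‖F y‖ ≤ a y * b y) : Integrable F := by
  refine Integrable.mono' ((ha.add hb).div_const 2) hFm (Eventually.of_forall fun y => ?_)
  have h := hle y
  show ‖F y‖ ≤ (a y ^ 2 + b y ^ 2) / 2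
  nlinarith [sq_nonneg (a y - b y)]

/-! ### Geometry of the far region -/

/-- If `|x₀ − y| ≥ R` and `|x − x₀| < R/2` then `|x − y| ≥ |x₀ − y|/2` (and in particular `x ≠ y`). -/
theorem half_norm_sub_le {R : ℝ} {x₀ x y : EuclideanSpace ℝ (Fin 3)} (hy : R ≤ ‖x₀ - y‖)
    (hx : ‖x - x₀‖ < R / 2) : ‖x₀ - y‖ / 2 ≤ ‖x - y‖ := by
  have h1 : ‖x₀ - y‖ ≤ ‖x₀ - x‖ + ‖x - y‖ := norm_sub_le_norm_sub_add_norm_sub x₀ x y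
  rw [norm_sub_rev x₀ x] at h1
  linarith

/-- Cubed and inverted: `|x − y|⁻³ ≤ 8|x₀ − y|⁻³` in the far region. -/
theorem inv_cube_le_eight_mul {R : ℝ} (hR : 0 < R) {x₀ x y : EuclideanSpace ℝ (Fin 3)}
    (hy : R ≤ ‖x₀ - y‖) (hx : ‖x - x₀‖ < R / 2) :
    (‖x - y‖ ^ 3)⁻¹ ≤ 8 * (‖x₀ - y‖ ^ 3)⁻¹ := by
  have h := half_norm_sub_le hy hx
  have hpos : 0 < ‖x₀ - y‖ / 2 := by linarith
  have h3 : (‖x₀ - y‖ / 2) ^ 3 ≤ ‖x - y‖ ^ 3 := pow_le_pow_left₀ hpos.le h 3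
  calc (‖x - y‖ ^ 3)⁻¹ ≤ ((‖x₀ - y‖ / 2) ^ 3)⁻¹ := inv_anti₀ (pow_pos hpos 3) h3
    _ = 8 * (‖x₀ - y‖ ^ 3)⁻¹ := by
        have hne : ‖x₀ - y‖ ≠ 0 := by linarith
        field_simp
        ring

/-- Squared and inverted: `|x − y|⁻² ≤ 4|x₀ − y|⁻²` in the far region. -/
theorem inv_sq_le_four_mul {R : ℝ} (hR : 0 < R) {x₀ x y : EuclideanSpace ℝ (Fin 3)}
    (hy : R ≤ ‖x₀ - y‖) (hx : ‖x - x₀‖ < R / 2) :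
    (‖x - y‖ ^ 2)⁻¹ ≤ 4 * (‖x₀ - y‖ ^ 2)⁻¹ := by
  have h := half_norm_sub_le hy hx
  have hpos : 0 < ‖x₀ - y‖ / 2 := by linarith
  have h2 : (‖x₀ - y‖ / 2) ^ 2 ≤ ‖x - y‖ ^ 2 := pow_le_pow_left₀ hpos.le h 2
  calc (‖x - y‖ ^ 2)⁻¹ ≤ ((‖x₀ - y‖ / 2) ^ 2)⁻¹ := inv_anti₀ (pow_pos hpos 2) h2
    _ = 4 * (‖x₀ - y‖ ^ 2)⁻¹ := by
        have hne : ‖x₀ - y‖ ≠ 0 := by linarith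
        field_simp
        ring

/-! ### The far field of the Biot–Savart integral is differentiable at the centre -/

/-- **The far field is harmless.** Let `K = biotSavartCLM` (`‖∇K(z)‖ ≤ A|z|⁻³`), `h : ℝ³ → ℝ³` continuous with
`∫‖h‖² < ∞` and `h = 0` on the ball `B(x₀, R)`, `R > 0`. Then (i) for `|x − x₀| < R/2` the Biot–Savart integrand
`y ↦ K(x − y) h(y)` is integrable; (ii) `K ∗ h = biotSavart h` has at `x₀` the derivative
`∫ (∇K(x₀ − y) ·)(h y) dy`; (iii) `‖∫ (∇K(x₀ − y) ·)(h y) dy‖ ≤ 8A ∫ ‖h(y)‖ 1_{|x₀−y| ≥ R}|x₀ − y|⁻³ dy`.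
Differentiation under the integral sign with the domination `8A‖h(y)‖1_{|x₀−y|≥R}|x₀−y|⁻³`. -/
theorem hasFDerivAt_biotSavart_far {A : ℝ} (hK : IsC1SingularKernel biotSavartCLM A)
    {h : EuclideanSpace ℝ (Fin 3) → EuclideanSpace ℝ (Fin 3)} (hc : Continuous h)
    (h2 : Integrable fun y => ‖h y‖ ^ 2) {x₀ : EuclideanSpace ℝ (Fin 3)} {R : ℝ} (hR : 0 < R)
    (hvan : ∀ y, ‖y - x₀‖ < R → h y = 0) :
    (∀ x, ‖x - x₀‖ < R / 2 → Integrable fun y => biotSavartCLM (x - y) (h y)) ∧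
    HasFDerivAt (biotSavart h) (∫ y, (fderiv ℝ biotSavartCLM (x₀ - y)).flip (h y)) x₀ ∧
    ‖∫ y, (fderiv ℝ biotSavartCLM (x₀ - y)).flip (h y)‖ ≤
      8 * A * ∫ y, ‖h y‖ * (ball (0 : EuclideanSpace ℝ (Fin 3)) R)ᶜ.indicator (fun z => (‖z‖ ^ 3)⁻¹) (x₀ - y) := by
  have hA : 0 ≤ A := hK.nonneg
  -- where `h ≠ 0` we are in the far region
  have hfar : ∀ y, h y ≠ 0 → R ≤ ‖x₀ - y‖ := by
    intro y hy
    by_contra hlt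
    rw [not_le, norm_sub_rev] at hlt
    exact hy (hvan y hlt)
  -- (i) absolute convergence of the integrand near `x₀`
  have hint : ∀ x, ‖x - x₀‖ < R / 2 → Integrable fun y => biotSavartCLM (x - y) (h y) := by
    intro x hx
    refine integrable_of_norm_le_mul_sq (aestronglyMeasurable_kernel_sub_apply hK hc x)
      (a := fun y => 4 * A * ‖h y‖)
      (b := fun y => (ball (0 : EuclideanSpace ℝ (Fin 3)) R)ᶜ.indicator (fun z => (‖z‖ ^ 2)⁻¹) (x₀ - y))
      ?_ (integrable_sq_farKernel le_rfl hR x₀) fun y => ?_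
    · have : (fun y => (4 * A * ‖h y‖) ^ 2) = fun y => (4 * A) ^ 2 * ‖h y‖ ^ 2 := by
        funext y; ring
      rw [this]
      exact h2.const_mul _
    · by_cases hy : h y = 0
      · rw [hy, map_zero, norm_zero]
        exact mul_nonneg (by positivity) (farKernel_nonneg 2 R _)
      · have hyfar := hfar y hy
        rw [farKernel_eq_of_le hyfar]
        calc ‖biotSavartCLM (x - y) (h y)‖ ≤ ‖biotSavartCLM (x - y)‖ * ‖h y‖ :=
              ContinuousLinearMap.le_opNorm _ _
          _ ≤ A * (‖x - y‖ ^ 2)⁻¹ * ‖h y‖ := by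
              gcongr
              exact hK.norm_le (x - y)
          _ ≤ A * (4 * (‖x₀ - y‖ ^ 2)⁻¹) * ‖h y‖ := by
              gcongr
              exact inv_sq_le_four_mul hR hyfar hx
          _ = 4 * A * ‖h y‖ * (‖x₀ - y‖ ^ 2)⁻¹ := by ring
  -- the dominating function of the derivative integrand: `8A‖h y‖1_{|x₀−y|≥R}|x₀−y|⁻³`
  have hbound0 : ∀ y, 0 ≤ 8 * A * ‖h y‖ *
      (ball (0 : EuclideanSpace ℝ (Fin 3)) R)ᶜ.indicator (fun z => (‖z‖ ^ 3)⁻¹) (x₀ - y) := fun y =>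
    mul_nonneg (by positivity) (farKernel_nonneg 3 R _)
  have hbd : ∀ y, ∀ x ∈ ball x₀ (R / 2), ‖(fderiv ℝ biotSavartCLM (x - y)).flip (h y)‖ ≤ 8 * A * ‖h y‖ *
      (ball (0 : EuclideanSpace ℝ (Fin 3)) R)ᶜ.indicator (fun z => (‖z‖ ^ 3)⁻¹) (x₀ - y) := by
    intro y x hx
    rw [mem_ball, dist_eq_norm] at hx
    by_cases hy : h y = 0
    · simp only [hy, map_zero, norm_zero, mul_zero, zero_mul, le_refl]
    · have hyfar := hfar y hy
      have hz : x - y ≠ 0 := by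
        intro h0
        have := half_norm_sub_le hyfar hx
        rw [h0, norm_zero] at this
        linarith
      rw [farKernel_eq_of_le hyfar]
      calc ‖(fderiv ℝ biotSavartCLM (x - y)).flip (h y)‖
          ≤ ‖(fderiv ℝ biotSavartCLM (x - y)).flip‖ * ‖h y‖ := ContinuousLinearMap.le_opNorm _ _
        _ = ‖fderiv ℝ biotSavartCLM (x - y)‖ * ‖h y‖ := by rw [ContinuousLinearMap.opNorm_flip]
        _ ≤ A * (‖x - y‖ ^ 3)⁻¹ * ‖h y‖ := by
            gcongr
            exact hK.norm_fderiv_le (x - y) hz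
        _ ≤ A * (8 * (‖x₀ - y‖ ^ 3)⁻¹) * ‖h y‖ := by
            gcongr
            exact inv_cube_le_eight_mul hR hyfar hx
        _ = 8 * A * ‖h y‖ * (‖x₀ - y‖ ^ 3)⁻¹ := by ring
  have hbi : Integrable fun y => 8 * A * ‖h y‖ *
      (ball (0 : EuclideanSpace ℝ (Fin 3)) R)ᶜ.indicator (fun z => (‖z‖ ^ 3)⁻¹) (x₀ - y) := by
    refine integrable_of_norm_le_mul_sq ?_ (a := fun y => 8 * A * ‖h y‖)
      (b := fun y => (ball (0 : EuclideanSpace ℝ (Fin 3)) R)ᶜ.indicator (fun z => (‖z‖ ^ 3)⁻¹) (x₀ - y))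
      ?_ (integrable_sq_farKernel (by norm_num) hR x₀) fun y => ?_
    · exact ((continuous_const.mul hc.norm).measurable.mul
        (measurable_farKernel_sub 3 R x₀)).aestronglyMeasurable
    · have : (fun y => (8 * A * ‖h y‖) ^ 2) = fun y => (8 * A) ^ 2 * ‖h y‖ ^ 2 := by
        funext y; ring
      rw [this]
      exact h2.const_mul _
    · rw [Real.norm_of_nonneg (hbound0 y)]
  -- (ii) differentiation under the integral sign
  have hx₀ : ‖x₀ - x₀‖ < R / 2 := by rw [sub_self, norm_zero]; positivity
  have hderiv : HasFDerivAt (biotSavart h) (∫ y, (fderiv ℝ biotSavartCLM (x₀ - y)).flip (h y)) x₀ := by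
    rw [← singularPotential_biotSavartCLM]
    unfold singularPotential
    refine hasFDerivAt_integral_of_dominated_of_fderiv_le (𝕜 := ℝ) (μ := volume) (s := ball x₀ (R / 2))
      (F := fun x y => biotSavartCLM (x - y) (h y))
      (F' := fun x y => (fderiv ℝ biotSavartCLM (x - y)).flip (h y))
      (bound := fun y => 8 * A * ‖h y‖ *
        (ball (0 : EuclideanSpace ℝ (Fin 3)) R)ᶜ.indicator (fun z => (‖z‖ ^ 3)⁻¹) (x₀ - y))
      (ball_mem_nhds x₀ (by positivity)) ?_ (hint x₀ hx₀) ?_ ?_ hbi ?_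
    · exact Eventually.of_forall fun x => aestronglyMeasurable_kernel_sub_apply hK hc x
    · exact aestronglyMeasurable_fderiv_flip_apply hK hc x₀
    · exact Eventually.of_forall hbd
    · refine Eventually.of_forall fun y x hx => ?_
      rw [mem_ball, dist_eq_norm] at hx
      by_cases hy : h y = 0
      · have hfun : (fun x : EuclideanSpace ℝ (Fin 3) => biotSavartCLM (x - y) (h y)) = fun _ => 0 := by
          funext x'; rw [hy, map_zero]
        rw [hfun, hy, map_zero]
        exact hasFDerivAt_const 0 x
      · have hyfar := hfar y hy
        have hz : x - y ≠ 0 := by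
          intro h0
          have := half_norm_sub_le hyfar hx
          rw [h0, norm_zero] at this
          linarith
        have h1 : HasFDerivAt biotSavartCLM (fderiv ℝ biotSavartCLM (x - y)) (x - y) :=
          ((hK.contDiffAt _ hz).differentiableAt one_ne_zero).hasFDerivAt
        have h2' : HasFDerivAt (fun x : EuclideanSpace ℝ (Fin 3) => x - y)
            (ContinuousLinearMap.id ℝ (EuclideanSpace ℝ (Fin 3))) x :=
          (hasFDerivAt_id x).sub_const y
        have h3 := h1.comp x h2'
        have h4 := h3.clm_apply (hasFDerivAt_const (h y) x)
        refine h4.congr_fderiv ?_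
        ext e
        simp
  -- (iii) the size of the derivative
  have hnorm : ‖∫ y, (fderiv ℝ biotSavartCLM (x₀ - y)).flip (h y)‖ ≤
      8 * A * ∫ y, ‖h y‖ *
        (ball (0 : EuclideanSpace ℝ (Fin 3)) R)ᶜ.indicator (fun z => (‖z‖ ^ 3)⁻¹) (x₀ - y) := by
    have h1 : ‖∫ y, (fderiv ℝ biotSavartCLM (x₀ - y)).flip (h y)‖ ≤ ∫ y, 8 * A * ‖h y‖ *
        (ball (0 : EuclideanSpace ℝ (Fin 3)) R)ᶜ.indicator (fun z => (‖z‖ ^ 3)⁻¹) (x₀ - y) :=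
      norm_integral_le_of_norm_le hbi
        (Eventually.of_forall fun y => hbd y x₀ (mem_ball_self (by positivity)))
    have h2 : ∫ y, 8 * A * ‖h y‖ *
        (ball (0 : EuclideanSpace ℝ (Fin 3)) R)ᶜ.indicator (fun z => (‖z‖ ^ 3)⁻¹) (x₀ - y) =
        8 * A * ∫ y, ‖h y‖ *
          (ball (0 : EuclideanSpace ℝ (Fin 3)) R)ᶜ.indicator (fun z => (‖z‖ ^ 3)⁻¹) (x₀ - y) := by
      rw [← integral_const_mul]
      refine integral_congr_ae (Eventually.of_forall fun y => ?_)
      simp only [mul_assoc]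
    rwa [h2] at h1
  exact ⟨hint, hderiv, hnorm⟩

end Summit.NavierStokesRegularity.NavierStokesRegularity.Theorems.ArgmaxDoors

end
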